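import Summits.CriticalPhenomena.PercolationContinuityZ3.Theorems.PercNearOneGluingNoHeavyLowerTailBlockExchange
import Literature.Probability.Percolation.KozmaNitzanPinning
import Literature.Probability.LatticeModels.ProdBernoulliIndependence
import Mathlib

/-!
# Crux `PercNearOneGluing.NoHeavyLowerTail` (stmt-CriticalPhenomena-4575), line
`bhk-superadditivity-thinning` — stub `starBlockExchangeLaw`

Helper file for the crux skeleton (lead prover-line-stmt-CriticalPhenomena-4575-c3-0): proves
exactly the registered stub signature `starBlockExchangeLaw`, the block-exchange hypothesis of the
Block Star Lemma for percolation laws, and lands with `--supports stmt-CriticalPhenomena-4575`.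

## Content

Weighted complete graph on `Fin n`, law `μ = prodBernoulli w` on `BondConfig (Fin n)`, a hub `o`,
a set `A ∌ o` of terminals, `b, m, h ∈ A`, `Z ⊆ A`, `z ∈ Z`.  Write `F_o` for the pairs containing
`o`, `H_o` for the other pairs, `x ~ y` for "`x ↔ y` by an open path avoiding `o`"
(`openConnIn {o}ᶜ x y`), `L(η) = {a ∈ A | a ~ b}` and `cl_x(η) = {a' ∈ A | x ~ a'}`.  If
`μ(z ≁ b) ≤ μ(m ≁ b)` then, summing over the patterns `η ⊆ H_o` with the cylinder weights
`μ[η]_{H_o}`,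

`Σ_η μ[η] 1{m ∈ L, h ∉ L, Z ∩ L = ∅, Z ∩ cl_h ≠ ∅} ≤ Σ_η μ[η] 1{m ∉ L, Z ∩ cl_m = ∅, Z ∩ L ≠ ∅, h ∉ cl_m}`.

## Proof

* Both sums are `μ` of events `E_A`, `E_B` determined by the pairs `H_o` (an `o`-avoiding
  connection never looks at a pair containing `o`), by the law of total probability over the
  patterns of `H_o` (`prodBernoulli_real_eq_sum_localCylinder`).
* Let `w⁰` be `w` with the pairs at `o` given weight `0`, `μ⁰ = prodBernoulli w⁰`.  Events
  determined by `H_o` have the same probability under `μ` and `μ⁰`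
  (`prodBernoulli_real_eq_of_determinedBy`), and `μ⁰`-almost surely no pair at `o` is open, so that
  for `x ≠ o` the events `{x ↔ y}` and `{x ~ y}` agree `μ⁰`-a.s.
* Hence `μ(E_A) = μ⁰(E_A) = μ⁰(E_A')` and `μ(E_B) = μ⁰(E_B')` with `E_A'`, `E_B'` the same events
  written with plain connections `↔`, and `μ⁰(E_A') ≤ μ⁰(E_B')` is the block exchange inequality
  `blockExchange` (`BX_{Z,h}`, from Kozma–Nitzan Lemma 3(ii)) for the weights `w⁰`, whose
  hypothesis `μ⁰(m ↔ b) ≤ μ⁰(z ↔ b)` is the transported assumption `μ(z ≁ b) ≤ μ(m ≁ b)`.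
-/

open scoped Classical

namespace Summit.CriticalPhenomena.PercolationContinuityZ3.Theorems

open MeasureTheory
open Literature.Probability.LatticeModels (prodBernoulli prodBernoulli_real_eq_of_determinedBy
  prodBernoulli_ae_forall_notMem)
open Literature.Probability.Percolation

noncomputable section

section StarBlockExchangeAux

variable {n : ℕ}

/-- **An isolated hub is invisible to connections.**  If no open pair of `ω` contains `o` and
`x ≠ o`, then `x ↔ y` in `ω` iff `x ↔ y` by an open path avoiding `o`: an open walk from `x`
can never enter the isolated vertex `o` (first-exit decomposition of the walk at `{o}ᶜ`).
[folklore] -/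
theorem starBX_openConn_iff_openConnIn {ω : BondConfig (Fin n)} {o : Fin n}
    (hω : ∀ e : Sym2 (Fin n), o ∈ e → e ∉ ω) {x : Fin n} (hx : x ≠ o) (y : Fin n) :
    ω ∈ (openConn x y : Set (BondConfig (Fin n))) ↔ ω ∈ openConnIn (({o} : Set (Fin n))ᶜ) x y := by
  constructor
  · intro h
    have hp := DCT16.pathIn_univ_of_reachable h
    have hxR : x ∈ (({o} : Set (Fin n))ᶜ) := by
      simpa only [Set.mem_compl_iff, Set.mem_singleton_iff] using hx
    rcases hp.exit_or hxR with hp' | ⟨a, c, -, hc, -, hac, -⟩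
    · exact DCT16.mem_openConnIn_of_pathIn (hp'.mono Set.inter_subset_left)
    · simp only [Set.mem_compl_iff, Set.mem_singleton_iff, not_not] at hc
      rw [openGraph_adj] at hac
      exact absurd hac.1 (hω _ (Sym2.mem_iff.2 (Or.inr hc.symm)))
  · intro h
    exact DCT16.reachable_of_pathIn ((DCT16.pathIn_of_mem_openConnIn h).mono (Set.subset_univ _))

/-- Under a product law giving weight `0` to every pair at `o`, almost surely no pair at `o` is
open, so for `x ≠ o` the events `{x ↔ y}` and `{x ↔ y avoiding o}` agree almost surely.
[folklore] -/
theorem starBX_ae_openConn_iff (w' : Sym2 (Fin n) → unitInterval) (o : Fin n)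
    (hw' : ∀ e : Sym2 (Fin n), o ∈ e → w' e = 0) :
    ∀ᵐ ω ∂(prodBernoulli w'), ∀ x y : Fin n, x ≠ o →
      (ω ∈ (openConn x y : Set (BondConfig (Fin n))) ↔ ω ∈ openConnIn (({o} : Set (Fin n))ᶜ) x y) := by
  have hZ : ({e : Sym2 (Fin n) | o ∈ e}).Countable := Set.to_countable _
  filter_upwards [prodBernoulli_ae_forall_notMem w' hZ (fun e he => hw' e he)] with ω hω x y hx
  exact starBX_openConn_iff_openConnIn (fun e he => hω e he) hx y

/-- The event `{x ↔ y avoiding o}` is determined by the pairs not containing `o`: the open graph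
induced on `{o}ᶜ` only uses such pairs. [folklore] -/
theorem starBX_determinedBy_openConnIn {o : Fin n} {Ho : Finset (Sym2 (Fin n))}
    (hHo : ∀ e : Sym2 (Fin n), e ∈ Ho ↔ o ∉ e) (x y : Fin n) :
    DeterminedBy (openConnIn (({o} : Set (Fin n))ᶜ) x y) (↑Ho : Set (Sym2 (Fin n))) := by
  refine DCT16.determinedBy_openConnIn _ x y (K := (↑Ho : Set (Sym2 (Fin n)))) ?_
  intro e he
  induction e using Sym2.ind with
  | _ a c =>
    rw [Set.mk_mem_sym2_iff] at he
    simp only [Set.mem_compl_iff, Set.mem_singleton_iff] at he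
    rw [Finset.mem_coe, hHo]
    intro hmem
    rcases Sym2.mem_iff.1 hmem with h1 | h1
    · exact he.1 h1.symm
    · exact he.2 h1.symm

/-- **Cylinder expansion of an event determined by `H_o`**: for `E` determined by the pairs of the
finite set `Ho` and any decidable predicate `P` on patterns agreeing with membership in `E`,
`Σ_{η ⊆ Ho} μ[η]_{Ho} · 1{P η} = μ(E)` (law of total probability over the patterns of `Ho`,
`prodBernoulli_real_eq_sum_localCylinder`). [folklore] -/
theorem starBX_sum_ite_eq_real (w : Sym2 (Fin n) → unitInterval) (Ho : Finset (Sym2 (Fin n)))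
    {E : Set (Set (Sym2 (Fin n)))} (hE : DeterminedBy E (↑Ho : Set (Sym2 (Fin n))))
    (P : Finset (Sym2 (Fin n)) → Prop) [DecidablePred P]
    (hP : ∀ η : Finset (Sym2 (Fin n)), P η ↔ (↑η : Set (Sym2 (Fin n))) ∈ E) :
    ∑ η ∈ Ho.powerset, (prodBernoulli w).real
        (localCylinder (↑Ho : Set (Sym2 (Fin n))) (↑η : Set (Sym2 (Fin n)))) *
      (if P η then (1 : ℝ) else 0) = (prodBernoulli w).real E := by
  rw [prodBernoulli_real_eq_sum_localCylinder w Ho hE, Finset.sum_filter]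
  refine Finset.sum_congr rfl fun η _ => ?_
  by_cases h : P η
  · have h' : (↑η : Set (Sym2 (Fin n))) ∈ E := (hP η).1 h
    simp [h, h']
  · have h' : (↑η : Set (Sym2 (Fin n))) ∉ E := fun h'' => h ((hP η).2 h'')
    simp [h, h']

end StarBlockExchangeAux

/-- **Block exchange for `o`-avoiding connection laws** (registered stub `starBlockExchangeLaw` of
crux stmt-CriticalPhenomena-4575, line bhk-superadditivity-thinning).  On the weighted complete
graph `Fin n` with law `μ = prodBernoulli w`, hub `o ∉ A`, `b, m, h ∈ A`, `Z ⊆ A`, `z ∈ Z`, and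
`~` = open connection avoiding `o`: if `μ(z ≁ b) ≤ μ(m ≁ b)` then, summing over the patterns `η`
of the pairs off `o` with their cylinder weights,
`Σ_η μ[η] 1{m ~ b, h ≁ b, Z ≁ b, h ~ Z} ≤ Σ_η μ[η] 1{m ≁ b, m ≁ Z, Z ~ b, m ≁ h}` (with `Z`
read through `A`).  Both sides are probabilities of events determined by the pairs off `o`; after
killing the weights at `o` they become plain-connection events, compared by `blockExchange`
(Kozma–Nitzan Lemma 3(ii)); see the module docstring. [cite: KozmaNitzan2024, Lemma 3(ii)] -/
theorem starBlockExchangeLaw : ∀ (n : ℕ) (w : Sym2 (Fin n) → unitInterval) (A : Finset (Fin n)) (o b m h z : Fin n) (Z : Finset (Fin n)), o ∉ A → b ∈ A → m ∈ A → h ∈ A → Z ⊆ A → z ∈ Z → (Literature.Probability.LatticeModels.prodBernoulli w).real (Literature.Probability.Percolation.openConnIn (({o} : Set (Fin n))ᶜ) z b)ᶜ ≤ (Literature.Probability.LatticeModels.prodBernoulli w).real (Literature.Probability.Percolation.openConnIn (({o} : Set (Fin n))ᶜ) m b)ᶜ → (∑ η ∈ ((Finset.univ : Finset (Sym2 (Fin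 n))) \ (Finset.univ : Finset (Sym2 (Fin n))).filter (fun e => o ∈ e)).powerset, (Literature.Probability.LatticeModels.prodBernoulli w).real (Literature.Probability.Percolation.localCylinder (↑((Finset.univ : Finset (Sym2 (Fin n))) \ (Finset.univ : Finset (Sym2 (Fin n))).filter (fun e => o ∈ e)) : Set (Sym2 (Fin n))) (↑η : Set (Sym2 (Fin n)))) * (if m ∈ A.filter (fun a => (↑η : Set (Sym2 (Fin n))) ∈ Literature.Probability.Percolation.openConnIn (({o} : Set (Fin n))ᶜ) a b) ∧ h ∉ A.filter (fun a => (↑η : Set (Sym2 (Fin n))) ∈ Literature.Probability.Percolation.openConnIn (({o} : Set (Fin n))ᶜ) a b) ∧ Disjoint Z (A.filter (fun a => (↑η : Set (Sym2 (Fin n))) ∈ Literature.Probability.Percolation.openConnIn (({o} : Set (Fin n))ᶜ) a b)) ∧ ¬ Disjoint Z (A.filter (fun a' => (↑η : Set (Sym2 (Fin n))) ∈ Literature.Probability.Percolation.openConnIn (({o} : Set (Fin n))ᶜ) h a')) then (1 : ℝ) else 0)) ≤ ∑ η ∈ ((Finset.univ : Finset (Sym2 (Fin n))) \ (Finset.univ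 : Finset (Sym2 (Fin n))).filter (fun e => o ∈ e)).powerset, (Literature.Probability.LatticeModels.prodBernoulli w).real (Literature.Probability.Percolation.localCylinder (↑((Finset.univ : Finset (Sym2 (Fin n))) \ (Finset.univ : Finset (Sym2 (Fin n))).filter (fun e => o ∈ e)) : Set (Sym2 (Fin n))) (↑η : Set (Sym2 (Fin n)))) * (if m ∉ A.filter (fun a => (↑η : Set (Sym2 (Fin n))) ∈ Literature.Probability.Percolation.openConnIn (({o} : Set (Fin n))ᶜ) a b) ∧ Disjoint Z (A.filter (fun a' => (↑η : Set (Sym2 (Fin n))) ∈ Literature.Probability.Percolation.openConnIn (({o} : Set (Fin n))ᶜ) m a')) ∧ ¬ Disjoint Z (A.filter (fun a => (↑η : Set (Sym2 (Fin n))) ∈ Literature.Probability.Percolation.openConnIn (({o} : Set (Fin n))ᶜ) a b)) ∧ h ∉ A.filter (fun a' => (↑η : Set (Sym2 (Fin n))) ∈ Literature.Probability.Percolation.openConnIn (({o} : Set (Fin n))ᶜ) m a') then (1 : ℝ) else 0) := by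
  intro n w A o b m h z Z hoA hbA hmA hhA hZA hzZ hle
  -- vertices of `A` differ from `o`
  have hmo : m ≠ o := fun h' => hoA (h' ▸ hmA)
  have hho : h ≠ o := fun h' => hoA (h' ▸ hhA)
  have hZo : ∀ z' ∈ Z, z' ≠ o := fun z' hz' h' => hoA (h' ▸ hZA hz')
  -- the pairs off `o`
  set Ho : Finset (Sym2 (Fin n)) := (Finset.univ : Finset (Sym2 (Fin n))) \
    (Finset.univ : Finset (Sym2 (Fin n))).filter (fun e => o ∈ e) with hHo_def
  have hHo : ∀ e : Sym2 (Fin n), e ∈ Ho ↔ o ∉ e := by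
    intro e
    simp [hHo_def]
  -- `o`-avoiding connections
  set S : Set (Fin n) := ({o} : Set (Fin n))ᶜ with hS
  have hdet : ∀ x y : Fin n, DeterminedBy (openConnIn S x y) (↑Ho : Set (Sym2 (Fin n))) :=
    fun x y => starBX_determinedBy_openConnIn hHo x y
  -- the weights with the pairs at `o` killed
  obtain ⟨w₀, hw₀off, hw₀on⟩ : ∃ w₀ : Sym2 (Fin n) → unitInterval,
      (∀ e ∈ (↑Ho : Set (Sym2 (Fin n))), w e = w₀ e) ∧ (∀ e : Sym2 (Fin n), o ∈ e → w₀ e = 0) := by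
    refine ⟨fun e => if o ∈ e then 0 else w e, fun e he => ?_, fun e he => ?_⟩
    · have : o ∉ e := (hHo e).1 (Finset.mem_coe.1 he)
      simp [this]
    · simp [he]
  have hae := starBX_ae_openConn_iff w₀ o hw₀on
  -- the two events
  set EA : Set (Set (Sym2 (Fin n))) := {ω | m ∈ A.filter (fun a => ω ∈ openConnIn S a b) ∧
      h ∉ A.filter (fun a => ω ∈ openConnIn S a b) ∧
      Disjoint Z (A.filter (fun a => ω ∈ openConnIn S a b)) ∧
      ¬ Disjoint Z (A.filter (fun a' => ω ∈ openConnIn S h a'))} with hEA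
  set EB : Set (Set (Sym2 (Fin n))) := {ω | m ∉ A.filter (fun a => ω ∈ openConnIn S a b) ∧
      Disjoint Z (A.filter (fun a' => ω ∈ openConnIn S m a')) ∧
      ¬ Disjoint Z (A.filter (fun a => ω ∈ openConnIn S a b)) ∧
      h ∉ A.filter (fun a' => ω ∈ openConnIn S m a')} with hEB
  have hEAdet : DeterminedBy EA (↑Ho : Set (Sym2 (Fin n))) := by
    rw [determinedBy_iff]
    intro ω ω' hωω'
    have hc : ∀ x y : Fin n, ω ∈ openConnIn S x y ↔ ω' ∈ openConnIn S x y :=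
      fun x y => (determinedBy_iff _ _).1 (hdet x y) ω ω' hωω'
    simp only [hEA, Set.mem_setOf_eq, hc]
  have hEBdet : DeterminedBy EB (↑Ho : Set (Sym2 (Fin n))) := by
    rw [determinedBy_iff]
    intro ω ω' hωω'
    have hc : ∀ x y : Fin n, ω ∈ openConnIn S x y ↔ ω' ∈ openConnIn S x y :=
      fun x y => (determinedBy_iff _ _).1 (hdet x y) ω ω' hωω'
    simp only [hEB, Set.mem_setOf_eq, hc]
  -- (1) both sides are probabilities of `EA`, `EB`
  rw [starBX_sum_ite_eq_real w Ho hEAdet, starBX_sum_ite_eq_real w Ho hEBdet]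
  rotate_left
  · exact fun _ => Iff.rfl
  · exact fun _ => Iff.rfl
  -- (2a) transfer to the killed weights
  rw [prodBernoulli_real_eq_of_determinedBy w w₀ hw₀off hEAdet hEAdet.measurableSet_of_finset,
    prodBernoulli_real_eq_of_determinedBy w w₀ hw₀off hEBdet hEBdet.measurableSet_of_finset]
  -- (2b) under the killed weights, `o`-avoiding connections are a.s. plain connections
  have hEA' : (prodBernoulli w₀).real EA = (prodBernoulli w₀).real
      {ω : BondConfig (Fin n) | ω ∈ openConn m b ∧ ω ∉ openConn h b ∧
        (∀ z' ∈ Z, ω ∉ openConn z' b) ∧ (∃ z' ∈ Z, ω ∈ openConn h z')} := by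
    refine measureReal_congr ?_
    filter_upwards [hae] with ω hω
    refine propext ?_
    change ω ∈ EA ↔ (ω ∈ (openConn m b : Set (BondConfig (Fin n))) ∧
      ω ∉ (openConn h b : Set (BondConfig (Fin n))) ∧
      (∀ z' ∈ Z, ω ∉ (openConn z' b : Set (BondConfig (Fin n)))) ∧
      (∃ z' ∈ Z, ω ∈ (openConn h z' : Set (BondConfig (Fin n)))))
    simp only [hEA, Set.mem_setOf_eq]
    constructor
    · rintro ⟨h1, h2, h3, h4⟩
      obtain ⟨z', hz', hm4⟩ := Finset.not_disjoint_iff.1 h4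
      refine ⟨(hω m b hmo).2 (Finset.mem_filter.1 h1).2,
        fun h' => h2 (Finset.mem_filter.2 ⟨hhA, (hω h b hho).1 h'⟩),
        fun z'' hz'' h' => Finset.disjoint_left.1 h3 hz''
          (Finset.mem_filter.2 ⟨hZA hz'', (hω z'' b (hZo z'' hz'')).1 h'⟩),
        ⟨z', hz', (hω h z' hho).2 (Finset.mem_filter.1 hm4).2⟩⟩
    · rintro ⟨h1, h2, h3, ⟨z', hz', h4⟩⟩
      refine ⟨Finset.mem_filter.2 ⟨hmA, (hω m b hmo).1 h1⟩,
        fun h' => h2 ((hω h b hho).2 (Finset.mem_filter.1 h').2),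
        Finset.disjoint_left.2 fun a ha ha' => h3 a ha
          ((hω a b (hZo a ha)).2 (Finset.mem_filter.1 ha').2),
        Finset.not_disjoint_iff.2 ⟨z', hz',
          Finset.mem_filter.2 ⟨hZA hz', (hω h z' hho).1 h4⟩⟩⟩
  have hEB' : (prodBernoulli w₀).real EB = (prodBernoulli w₀).real
      {ω : BondConfig (Fin n) | ω ∉ openConn m b ∧ (∀ z' ∈ Z, ω ∉ openConn m z') ∧
        (∃ z' ∈ Z, ω ∈ openConn z' b) ∧ ω ∉ openConn m h} := by
    refine measureReal_congr ?_
    filter_upwards [hae] with ω hω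
    refine propext ?_
    change ω ∈ EB ↔ (ω ∉ (openConn m b : Set (BondConfig (Fin n))) ∧
      (∀ z' ∈ Z, ω ∉ (openConn m z' : Set (BondConfig (Fin n)))) ∧
      (∃ z' ∈ Z, ω ∈ (openConn z' b : Set (BondConfig (Fin n)))) ∧
      ω ∉ (openConn m h : Set (BondConfig (Fin n))))
    simp only [hEB, Set.mem_setOf_eq]
    constructor
    · rintro ⟨h1, h2, h3, h4⟩
      obtain ⟨z', hz', hm3⟩ := Finset.not_disjoint_iff.1 h3
      refine ⟨fun h' => h1 (Finset.mem_filter.2 ⟨hmA, (hω m b hmo).1 h'⟩),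
        fun z'' hz'' h' => Finset.disjoint_left.1 h2 hz''
          (Finset.mem_filter.2 ⟨hZA hz'', (hω m z'' hmo).1 h'⟩),
        ⟨z', hz', (hω z' b (hZo z' hz')).2 (Finset.mem_filter.1 hm3).2⟩,
        fun h' => h4 (Finset.mem_filter.2 ⟨hhA, (hω m h hmo).1 h'⟩)⟩
    · rintro ⟨h1, h2, ⟨z', hz', h3⟩, h4⟩
      refine ⟨fun h' => h1 ((hω m b hmo).2 (Finset.mem_filter.1 h').2),
        Finset.disjoint_left.2 fun a ha ha' => h2 a ha
          ((hω m a hmo).2 (Finset.mem_filter.1 ha').2),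
        Finset.not_disjoint_iff.2 ⟨z', hz',
          Finset.mem_filter.2 ⟨hZA hz', (hω z' b (hZo z' hz')).1 h3⟩⟩,
        fun h' => h4 ((hω m h hmo).2 (Finset.mem_filter.1 h').2)⟩
  -- (2c) the transported hypothesis `μ⁰(m ↔ b) ≤ μ⁰(z ↔ b)`
  have hconn : ∀ x : Fin n, x ≠ o →
      (prodBernoulli w₀).real (openConn x b) = (prodBernoulli w).real (openConnIn S x b) := by
    intro x hx
    rw [prodBernoulli_real_eq_of_determinedBy w w₀ hw₀off (hdet x b)
      (hdet x b).measurableSet_of_finset]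
    refine measureReal_congr ?_
    filter_upwards [hae] with ω hω
    exact propext (hω x b hx)
  have hle' : (prodBernoulli w₀).real (openConn m b) ≤ (prodBernoulli w₀).real (openConn z b) := by
    rw [hconn m hmo, hconn z (hZo z hzZ)]
    rw [probReal_compl_eq_one_sub MeasurableSet.of_discrete,
      probReal_compl_eq_one_sub MeasurableSet.of_discrete] at hle
    linarith
  -- (3) the block exchange inequality for the killed weights
  rw [hEA', hEB']
  exact blockExchange n w₀ m z b h Z hzZ hle'

end

end Summit.CriticalPhenomena.PercolationContinuityZ3.Theorems
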